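import Literature.NumberTheory.QuadraticFields.FormIdeals
import Mathlib.RingTheory.PrincipalIdealDomain
import HarnessLib

/-!
# Ideals of a quadratic ring: every ideal is `g · (A, ω − k)`; products of form ideals

Topic `NumberTheory/QuadraticFields`, namespace `Literature.NumberTheory.QuadraticFields.Quadratic`
(continuing `FormIdeals.lean`: a commutative ring `R` with `ℤ`-basis `b = (1, ω)`, `ω² = m + tω`,
the lattice ideals `(A, η)`, `η = ω − k`, `AC = k² − tk − m`). Everything here is PROVED
(theorems only), for use in the count of `Γ₀(N)`-classes of Heegner forms by the class number
(`Literature.NumberTheory.EllipticCurves.HeegnerDatum.card_reps_eq_classNumber`, Gross 1984, §I.1):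

* `span_singleton_mul_span_pair`: `(g)(A, η) = (gA, gη)`;
* **structure of ideals** (`exists_eq_span_singleton_mul_span_pair`): in a quadratic *domain*
  every non-zero ideal is `(g) · (A, ω − k)` with `g, A > 0` and `AC = k² − tk − m` for some `C`
  — i.e. `g` times the ideal of the form `(A, 2k − t, C)` of discriminant `t² + 4m` (Cox, *Primes
  of the form x² + ny²*, Thm. 7.7(i)⟸ / Exercise 7.12: every (proper) ideal of the order is
  `α[a, (−b + √D)/2]`; here with `α = g ∈ ℤ`, from the Hermite normal form of the lattice);
* `span_pair_eq_span_pair_of_dvd_sub`: `(A, ω − k) = (A, ω − k')` when `A ∣ k − k'` (the ideal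
  depends on `B = 2k − t` only modulo `2A`);
* **multiplication by the ideal `𝔫 = (N, ω − k)`** (`span_pair_mul_span_pair_of_isCoprime`):
  `(a, ω − k)(N, ω − k) = (aN, ω − k)` when `gcd(a, N) = 1` and `aN ∣ k² − tk − m` (the
  composition `[a, η][N, η] = [aN, η]` of "united" forms, Cox (7.12)/Lemma 3.2 in the concordant
  case; for Heegner forms: `(A, B, C) ↦ 𝔞 = 𝔟 𝔫`, Gross 1984, §I.1).

Mathlib has principal ideals of `ℤ` (`IsPrincipalIdealRing ℤ`, `Int.span_natAbs`),
`Ideal.span_pair_mul_span_pair`, `Submodule.map`; no structure theory of ideals in quadratic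
orders (searched `quadratic` + `ideal`, `Zsqrtd` ideals: only `GaussianInt` Euclidean facts).

## References

* D. A. Cox, *Primes of the form x² + ny²*, 2nd ed., Wiley (2013), §7.A–B ((7.9), (7.12),
  Thm. 7.7, Exercises 7.11–7.12), §3.A Lemma 3.2.
* B. H. Gross, *Heegner points on `X₀(N)`*, in *Modular Forms* (Durham 1983), Horwood (1984),
  87–105, §I.1.
-/

noncomputable section

open Module

namespace Literature.NumberTheory.QuadraticFields.Quadratic

section CommRing

variable {R : Type*} [CommRing R]

/-- `(g) · (A, η) = (gA, gη)` in a commutative ring. [folklore] -/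
theorem span_singleton_mul_span_pair (g A η : R) :
    Ideal.span {g} * Ideal.span {A, η} = Ideal.span {g * A, g * η} := by
  apply le_antisymm
  · rw [Ideal.mul_le]
    intro r hr s hs
    obtain ⟨r', rfl⟩ := Ideal.mem_span_singleton'.mp hr
    obtain ⟨α, β, rfl⟩ := Ideal.mem_span_pair.mp hs
    have : r' * g * (α * A + β * η) = (r' * α) * (g * A) + (r' * β) * (g * η) := by ring
    rw [this]
    exact Ideal.add_mem _ (Ideal.mul_mem_left _ _ (Ideal.subset_span (by simp)))
      (Ideal.mul_mem_left _ _ (Ideal.subset_span (by simp)))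
  · rw [Ideal.span_le]
    rintro x (rfl | rfl)
    · exact Ideal.mul_mem_mul (Ideal.mem_span_singleton_self g) (Ideal.subset_span (by simp))
    · exact Ideal.mul_mem_mul (Ideal.mem_span_singleton_self g) (Ideal.subset_span (by simp))

/-- `(A, ω − k) = (A, ω − k')` when `A ∣ k − k'`: the form ideal depends on `B = 2k − t` only
modulo `2A` (Cox, §2.A: `(a, b, c) ∼ (a, b + 2ak, ·)`). [folklore] -/
theorem span_pair_eq_span_pair_of_dvd_sub (ω : R) {A k k' : ℤ} (h : A ∣ k - k') :
    Ideal.span {(A : R), ω - k} = Ideal.span {(A : R), ω - k'} := by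
  obtain ⟨c, hc⟩ := h
  have : (ω - k : R) = (ω - k') + (-c : R) * A := by
    have hc' : (k : R) = k' + A * c := by
      have := congrArg (Int.cast : ℤ → R) (show k = k' + A * c by linarith)
      push_cast at this
      exact this
    rw [hc']
    ring
  rw [this, Ideal.span_pair_add_mul_left]

end CommRing

section QuadraticRing

variable {R : Type*} [CommRing R] (b : Basis (Fin 2) ℤ R) (hb : b 0 = 1)
  {t m : ℤ} (hω : b 1 * b 1 = (m : R) + (t : R) * b 1)

include hb hω in
/-- **Structure of ideals in a quadratic domain.** Let `R` be a domain with `ℤ`-basis `(1, ω)`,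
`ω² = m + tω`. Every non-zero ideal `I` of `R` is `I = (g) · (A, ω − k)` with integers `g, A > 0`,
`k`, `C` such that `AC = k² − tk − m`; i.e. `I = g · [A, (−B + √D)/2]` for the form `(A, B, C)`,
`B = 2k − t`, of discriminant `D = t² + 4m` (Cox, *Primes of the form x² + ny²*, §7.B, Thm. 7.7
with Exercise 7.12; proof by the Hermite normal form: `I ∩ ℤ = (a)`, the `ω`-coordinates of `I`
form `(g)`, `I = ℤa ⊕ ℤ(c₀ + gω)`, and `ω I ⊆ I` gives `g ∣ a`, `g ∣ c₀`, `a/g ∣ N(ω + c₀/g)`).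
[cite: Cox2013, §7.B Thm. 7.7] -/
theorem exists_eq_span_singleton_mul_span_pair [IsDomain R] {I : Ideal R} (hI : I ≠ ⊥) :
    ∃ g A k C : ℤ, 0 < g ∧ 0 < A ∧ A * C = k ^ 2 - t * k - m ∧
      I = Ideal.span {(g : R)} * Ideal.span {(A : R), b 1 - k} := by
  classical
  -- a non-zero integer in `I`
  obtain ⟨x, hxI, hx0⟩ := Submodule.exists_mem_ne_zero_of_ne_bot hI
  obtain ⟨n, hn0, hnx⟩ := exists_intCast_ne_zero_mem_span b hb hω hx0
  have hnI : (n : R) ∈ I := (Ideal.span_singleton_le_iff_mem I).mpr hxI hnx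
  -- `I ∩ ℤ = (a)`, `a > 0`
  set I₀ : Ideal ℤ := I.comap (Int.castRingHom R) with hI₀
  have hmemI₀ : ∀ z : ℤ, z ∈ I₀ ↔ (z : R) ∈ I := fun z ↦ by
    simp [hI₀, Ideal.mem_comap]
  obtain ⟨a₀, ha₀⟩ := Submodule.IsPrincipal.principal I₀
  set a : ℤ := (a₀.natAbs : ℤ) with ha
  have hI₀a : I₀ = Ideal.span {a} := by
    rw [ha, Int.span_natAbs, ha₀, Ideal.submodule_span_eq]
  have hdvdI₀ : ∀ z : ℤ, (z : R) ∈ I ↔ a ∣ z := fun z ↦ by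
    rw [← hmemI₀, hI₀a, Ideal.mem_span_singleton]
  have ha0 : a ≠ 0 := by
    intro h0
    have := (hdvdI₀ n).mp hnI
    rw [h0, zero_dvd_iff] at this
    exact hn0 this
  have ha_pos : 0 < a := by omega
  have haI : (a : R) ∈ I := (hdvdI₀ a).mpr dvd_rfl
  -- the `ω`-coordinates of `I` form `(g)`, `g > 0`
  set φ : R →ₗ[ℤ] ℤ := (Finsupp.lapply 1).comp b.repr.toLinearMap with hφdef
  have hφ : ∀ y, φ y = b.repr y 1 := fun y ↦ rfl
  set I₁ : Ideal ℤ := Submodule.map φ (I.restrictScalars ℤ) with hI₁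
  have hmemI₁ : ∀ z : ℤ, z ∈ I₁ ↔ ∃ y ∈ I, b.repr y 1 = z := fun z ↦ by
    simp only [hI₁, Submodule.mem_map, Submodule.restrictScalars_mem, hφ]
  obtain ⟨g₀, hg₀⟩ := Submodule.IsPrincipal.principal I₁
  set g : ℤ := (g₀.natAbs : ℤ) with hg
  have hI₁g : I₁ = Ideal.span {g} := by
    rw [hg, Int.span_natAbs, hg₀, Ideal.submodule_span_eq]
  have hdvdI₁ : ∀ y ∈ I, g ∣ b.repr y 1 := fun y hy ↦ by
    rw [← Ideal.mem_span_singleton, ← hI₁g]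
    exact (hmemI₁ _).mpr ⟨y, hy, rfl⟩
  -- `a ω ∈ I` has coordinate `a`, so `g ∣ a` and `g ≠ 0`
  have hga : g ∣ a := by
    have h := hdvdI₁ _ (I.mul_mem_right (b 1) haI)
    have hval : b.repr ((a : R) * b 1) 1 = a := by
      have : (a : R) * b 1 = ((0 : ℤ) : R) + (a : R) * b 1 := by push_cast; ring
      rw [this, repr_intCast_add_intCast_mul_one b hb]
    rwa [hval] at h
  have hg0 : g ≠ 0 := by
    intro h0
    rw [h0, zero_dvd_iff] at hga
    exact ha0 hga
  have hg_pos : 0 < g := by omega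
  -- an element `x_g = c₀ + g ω ∈ I`
  have hg_mem : g ∈ I₁ := by rw [hI₁g]; exact Ideal.mem_span_singleton_self g
  obtain ⟨xg, hxgI, hxg1⟩ := (hmemI₁ g).mp hg_mem
  set c₀ : ℤ := b.repr xg 0 with hc₀
  have hxg : xg = (c₀ : R) + (g : R) * b 1 := by
    rw [← hxg1, hc₀]
    exact eq_repr_add_repr_mul_of_basis b hb xg
  -- `I = ℤ a + ℤ x_g`
  have hdecomp : ∀ y ∈ I, ∃ u q : ℤ, y = u * a + q * xg := by
    intro y hy
    obtain ⟨q, hq⟩ := hdvdI₁ y hy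
    set r₀ : ℤ := b.repr y 0 with hr₀
    have hy' : y = (r₀ : R) + ((g * q : ℤ) : R) * b 1 := by
      rw [hr₀, ← hq]
      exact eq_repr_add_repr_mul_of_basis b hb y
    have hdiff : y - q * xg = ((r₀ - q * c₀ : ℤ) : R) := by
      rw [hy', hxg]
      push_cast
      ring
    have hdiffI : ((r₀ - q * c₀ : ℤ) : R) ∈ I :=
      hdiff ▸ I.sub_mem hy (I.mul_mem_left _ hxgI)
    obtain ⟨u, hu⟩ := (hdvdI₀ _).mp hdiffI
    refine ⟨u, q, ?_⟩
    have : y = (y - q * xg) + q * xg := by ring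
    rw [this, hdiff, hu]
    push_cast
    ring
  -- `ω x_g ∈ I` gives `g ∣ c₀`
  have hgc : g ∣ c₀ := by
    have h := hdvdI₁ _ (I.mul_mem_left (b 1) hxgI)
    have hval : b.repr (b 1 * xg) 1 = c₀ + g * t := by
      have : b 1 * xg = ((g * m : ℤ) : R) + ((c₀ + g * t : ℤ) : R) * b 1 := by
        rw [hxg]
        push_cast
        linear_combination (g : R) * hω
      rw [this, repr_intCast_add_intCast_mul_one b hb]
    rw [hval] at h
    exact (dvd_add_left (dvd_mul_right g t)).mp h
  obtain ⟨a', ha'⟩ := hga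
  obtain ⟨c', hc'⟩ := hgc
  have ha'_pos : 0 < a' := by
    rcases lt_trichotomy a' 0 with h | h | h
    · nlinarith
    · rw [h, mul_zero] at ha'; exact absurd ha' ha0
    · exact h
  -- `k = -c'`, `x_g = g (ω - k)`
  set k : ℤ := -c' with hk
  have hxgη : xg = (g : R) * (b 1 - k) := by
    rw [hxg, hc', hk]
    push_cast
    ring
  -- `a' ∣ N(ω - k)`: `g · N(ω - k) = (t - k) x_g - ω x_g ∈ I`
  have hnI' : ((g * (k ^ 2 - t * k - m) : ℤ) : R) ∈ I := by
    have : ((g * (k ^ 2 - t * k - m) : ℤ) : R) = ((t - k : ℤ) : R) * xg - b 1 * xg := by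
      rw [hxgη]
      push_cast
      linear_combination (g : R) * hω
    rw [this]
    exact I.sub_mem (I.mul_mem_left _ hxgI) (I.mul_mem_left _ hxgI)
  have hdiv : g * a' ∣ g * (k ^ 2 - t * k - m) := ha' ▸ (hdvdI₀ _).mp hnI'
  obtain ⟨C, hC⟩ := (mul_dvd_mul_iff_left hg0).mp hdiv
  refine ⟨g, a', k, C, hg_pos, ha'_pos, hC.symm, ?_⟩
  -- `I = (g)(a', ω - k)`
  rw [span_singleton_mul_span_pair]
  apply le_antisymm
  · intro y hy
    obtain ⟨u, q, rfl⟩ := hdecomp y hy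
    have : (u : R) * a + q * xg = u * ((g : R) * a') + q * ((g : R) * (b 1 - k)) := by
      rw [hxgη, ha']
      push_cast
      ring
    rw [this]
    exact Ideal.add_mem _ (Ideal.mul_mem_left _ _ (Ideal.subset_span (by simp)))
      (Ideal.mul_mem_left _ _ (Ideal.subset_span (by simp)))
  · rw [Ideal.span_le]
    rintro y (rfl | rfl)
    · have : (g : R) * a' = (a : R) := by rw [ha']; push_cast; ring
      rw [this]
      exact haI
    · rw [← hxgη]
      exact hxgI

include hω in
/-- **Product with the ideal `𝔫 = (N, η)`.** For `η = ω − k` with `aN ∣ N(η)` (i.e.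
`aNC = k² − tk − m`) and `gcd(a, N) = 1`: `(a, η) · (N, η) = (aN, η)` — the ideal of the Heegner
form `(aN, 2k − t, C)` is the product of the ideal of `(a, 2k − t, NC)` and `𝔫 = (N, η)` (Gross
1984, §I.1: `𝔞 ⊂ 𝔫⁻¹𝔞`; the composition of concordant forms, Cox Lemma 3.2/(7.12)). [folklore] -/
theorem span_pair_mul_span_pair_of_isCoprime {a N k C : ℤ} (hco : IsCoprime a N)
    (hn : a * N * C = k ^ 2 - t * k - m) :
    Ideal.span {(a : R), b 1 - k} * Ideal.span {(N : R), b 1 - k} =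
      Ideal.span {((a * N : ℤ) : R), b 1 - k} := by
  set η : R := b 1 - k with hη
  have hηη : η * η = ((t - 2 * k : ℤ) : R) * η - (C : R) * ((a * N : ℤ) : R) := by
    have h := sub_mul_sub_eq b hω k
    rw [← hn] at h
    rw [hη, h]
    push_cast
    ring
  rw [Ideal.span_pair_mul_span_pair]
  apply le_antisymm
  · rw [Ideal.span_le]
    have hgen₁ : ((a * N : ℤ) : R) ∈ Ideal.span {((a * N : ℤ) : R), η} := Ideal.subset_span (by simp)
    have hgen₂ : η ∈ Ideal.span {((a * N : ℤ) : R), η} := Ideal.subset_span (by simp)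
    rintro y (rfl | rfl | rfl | rfl)
    · push_cast at hgen₁ ⊢
      exact hgen₁
    · exact Ideal.mul_mem_left _ _ hgen₂
    · exact Ideal.mul_mem_right _ _ hgen₂
    · rw [hηη]
      exact Ideal.sub_mem _ (Ideal.mul_mem_left _ _ hgen₂) (Ideal.mul_mem_left _ _ hgen₁)
  · rw [Ideal.span_le]
    obtain ⟨u, v, huv⟩ := hco
    rintro y (rfl | rfl)
    · have : ((a * N : ℤ) : R) = (a : R) * N := by push_cast; ring
      rw [this]
      exact Ideal.subset_span (by simp)
    · have : η = (u : R) * ((a : R) * η) + (v : R) * (η * N) := by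
        have h1 := congrArg (Int.cast : ℤ → R) huv
        push_cast at h1
        linear_combination (-η) * h1
      have hmem : (u : R) * ((a : R) * η) + (v : R) * (η * N) ∈
          Ideal.span {(a : R) * N, (a : R) * η, η * N, η * η} :=
        Ideal.add_mem _ (Ideal.mul_mem_left _ _ (Ideal.subset_span (by simp)))
          (Ideal.mul_mem_left _ _ (Ideal.subset_span (by simp)))
      rwa [← this] at hmem

end QuadraticRing

end Literature.NumberTheory.QuadraticFields.Quadratic

end
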